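import Summits.CriticalPhenomena.PercolationContinuityZ3.Theorems.PercNearOneGluingNoHeavyLowerTailSahiMixtureTop
import Literature.Combinatorics.Sahi2008.SetPartitionForm

/-!
# TOP(5) in defect form: OR-ing an independent coin into all FIVE members is Bernstein-positive as soon as `E_5(A) ≥ 0`

Support file of the one-cut programme (crux `NoHeavyLowerTail`, stmt-CriticalPhenomena-4575; cell `prim-masterthm`, seat P3, gen 6;
`run/shared/lean/prim/prim-masterthm/prim-masterthm-p3/HIERARCHY.md` §13(e)).  Continues `…SahiMixtureTop` (m = 3, 4) with the last case in which the defect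
pieces `−T^{(k)}`, `k ≥ 3`, are polynomials with nonnegative coefficients in the atoms (m ≤ 5; from m = 9 on they are not, HIERARCHY §13(e)):
  `T(λ) = λ(1−λ)·T^{(1)} + λ²·E_5(A) + (λ²−λ³)(−T^{(3)}) + (λ²−λ⁴)(−T^{(4)}) + (λ²−λ⁵)(−T^{(5)})`,  `λ = 1 − h`,
with `T^{(1)} = 6·μ(|C| ≤ 3)`, `−T^{(5)} = Π_i μ(Ā_i)`, `−T^{(4)} = Σ_l Π_{r≠l} μ(Ā_r) + ½Σ_{i≠l} μ(A_i∖A_l)Π_{r∉{i,l}} μ(Ā_r)`, and for `−T^{(3)}` the explicit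
fractional cover found by this seat: `−T^{(3)} = (2/3)Σ_{S={i,j,k}} [μ(A_jA_k∖A_i) + μ(A_iA_k∖A_j) + μ(A_iA_j∖A_k)]·μ(Ā_r)μ(Ā_s)
 + Σ_{(ab|cd|e)} μ(Ā_e)[⅓ D_ab D_cd + ⅙ D_ab μ(A_d∖A_c) + ⅙ D_ab μ(A_c∖A_d) + ⅙ D_cd μ(A_b∖A_a) + ⅙ D_cd μ(A_a∖A_b)]`, `D_ab = 1 − μ(A_aA_b)` (15 pair-pair-point
patterns) — every piece a product of probabilities.  Exact pre-check of the identity and of `−T^{(k)} = N_k` (k = 3,4,5): seat script `code-g6/top5_identity.py`.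
* `exc_or₅` — fifth coin moment of OR-mixture indicators.
* `sahiE_five_orCoin_top_eq` — the identity (from the tree's printed `E_5`, `sahiE_five`).
* **`bernsteinPos_five_orCoin_top`** — `E_5(A) ≥ 0 ⇒ h ↦ E_5(A_0∪H,…,A_4∪H)` Bernstein-positive of degree 5; with ttrl cp-mix's exact check this is the
  structural content of "c_j − C(3,j)E_5 ∈ ℕ[atoms]" (MIXCOMB §9).  HONEST FRAMING: m ≤ 5 only; TOP(m) for m ≥ 6 is open (CONJECTURE P). [this work]
-/

noncomputable section

open scoped Classical

namespace Summit.CriticalPhenomena.PercolationContinuityZ3.Theorems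

open Finset Function
open Literature.Combinatorics.Sahi2008
open Literature.Probability.Percolation.BHK2006 (ind_le_one)
open Literature.Probability.Percolation.DecisionTree (ind ind_of_mem ind_of_not_mem ind_nonneg)

namespace SahiMixture

section TopFive

variable {α : Type*} [Fintype α] {μ : α → ℝ} (hμ : ∀ a, 0 ≤ μ a) (hμ1 : ∑ a, μ a = 1) (A0 A1 A2 A3 A4 : Set α)

omit [Fintype α] in
/-- Products of five OR-mixture indicators off/on the coin. [this work] -/
theorem prod_ind_orCoin₅ (X Y Z W V : Set α) (b₁ b₂ b₃ b₄ b₅ : Bool) (a : α) (ξ : Bool) :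
    (ind (orCoin X b₁) * ind (orCoin Y b₂) * ind (orCoin Z b₃) * ind (orCoin W b₄) * ind (orCoin V b₅)) (a, ξ)
      = bif ξ then ((bif b₁ then 1 else ind X) * (bif b₂ then 1 else ind Y) * (bif b₃ then 1 else ind Z) * (bif b₄ then 1 else ind W)
          * (bif b₅ then 1 else ind V)) a
        else (ind X * ind Y * ind Z * ind W * ind V) a := by
  cases ξ <;> cases b₁ <;> cases b₂ <;> cases b₃ <;> cases b₄ <;> cases b₅ <;> simp

/-- Fifth coin moment of OR-mixture indicators. [this work] -/
theorem exc_or₅ (μ : α → ℝ) (h : ℝ) (X Y Z W V : Set α) (b₁ b₂ b₃ b₄ b₅ : Bool) :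
    ex (coinWeight μ h) (ind (orCoin X b₁) * ind (orCoin Y b₂) * ind (orCoin Z b₃) * ind (orCoin W b₄) * ind (orCoin V b₅)) =
      (1 - h) * ex μ (ind X * ind Y * ind Z * ind W * ind V)
        + h * ex μ ((bif b₁ then 1 else ind X) * (bif b₂ then 1 else ind Y) * (bif b₃ then 1 else ind Z) * (bif b₄ then 1 else ind W)
            * (bif b₅ then 1 else ind V)) := by
  rw [ex_coinWeight]
  congr 2 <;> (congr 1; funext a; rw [prod_ind_orCoin₅]; rfl)

include hμ hμ1 in
/-- `1 − E[f] ≥ 0` for `f ≤ 1` pointwise under a probability weight. [folklore] -/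
theorem one_sub_ex_nonneg_of_le_one (f : α → ℝ) (hf : ∀ x, f x ≤ 1) : 0 ≤ 1 - ex μ f :=
  sub_nonneg.2 ((ex_mono hμ hf).trans_eq (ex_one hμ1))

include hμ1 in
set_option maxHeartbeats 1600000 in
/-- **TOP(5) in defect form** (see the module docstring for the pieces). [this work] -/
theorem sahiE_five_orCoin_top_eq (h : ℝ) :
    sahiE (coinWeight μ h) 5
        ![ind (orCoin A0 true), ind (orCoin A1 true), ind (orCoin A2 true), ind (orCoin A3 true), ind (orCoin A4 true)]
      = h * (1 - h) * (6 * (1 - (ex μ (ind A1 * ind A2 * ind A3 * ind A4) + ex μ (ind A0 * ind A2 * ind A3 * ind A4) + ex μ (ind A0 * ind A1 * ind A3 * ind A4) + ex μ (ind A0 * ind A1 * ind A2 * ind A4) + ex μ (ind A0 * ind A1 * ind A2 * ind A3)) + 4 * ex μ (ind A0 * ind A1 * ind A2 * ind A3 * ind A4)))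
        + (1 - h) ^ 2 * sahiE μ 5 ![ind A0, ind A1, ind A2, ind A3, ind A4]
        + h * (1 - h) ^ 2 *
          ((2 / 3) * (((ex μ (ind A1 * ind A2) - ex μ (ind A0 * ind A1 * ind A2)) + (ex μ (ind A0 * ind A2) - ex μ (ind A0 * ind A1 * ind A2)) + (ex μ (ind A0 * ind A1) - ex μ (ind A0 * ind A1 * ind A2))) * (1 - ex μ (ind A3)) * (1 - ex μ (ind A4))
            + ((ex μ (ind A1 * ind A3) - ex μ (ind A0 * ind A1 * ind A3)) + (ex μ (ind A0 * ind A3) - ex μ (ind A0 * ind A1 * ind A3)) + (ex μ (ind A0 * ind A1) - ex μ (ind A0 * ind A1 * ind A3))) * (1 - ex μ (ind A2)) * (1 - ex μ (ind A4))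
            + ((ex μ (ind A1 * ind A4) - ex μ (ind A0 * ind A1 * ind A4)) + (ex μ (ind A0 * ind A4) - ex μ (ind A0 * ind A1 * ind A4)) + (ex μ (ind A0 * ind A1) - ex μ (ind A0 * ind A1 * ind A4))) * (1 - ex μ (ind A2)) * (1 - ex μ (ind A3))
            + ((ex μ (ind A2 * ind A3) - ex μ (ind A0 * ind A2 * ind A3)) + (ex μ (ind A0 * ind A3) - ex μ (ind A0 * ind A2 * ind A3)) + (ex μ (ind A0 * ind A2) - ex μ (ind A0 * ind A2 * ind A3))) * (1 - ex μ (ind A1)) * (1 - ex μ (ind A4))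
            + ((ex μ (ind A2 * ind A4) - ex μ (ind A0 * ind A2 * ind A4)) + (ex μ (ind A0 * ind A4) - ex μ (ind A0 * ind A2 * ind A4)) + (ex μ (ind A0 * ind A2) - ex μ (ind A0 * ind A2 * ind A4))) * (1 - ex μ (ind A1)) * (1 - ex μ (ind A3))
            + ((ex μ (ind A3 * ind A4) - ex μ (ind A0 * ind A3 * ind A4)) + (ex μ (ind A0 * ind A4) - ex μ (ind A0 * ind A3 * ind A4)) + (ex μ (ind A0 * ind A3) - ex μ (ind A0 * ind A3 * ind A4))) * (1 - ex μ (ind A1)) * (1 - ex μ (ind A2))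
            + ((ex μ (ind A2 * ind A3) - ex μ (ind A1 * ind A2 * ind A3)) + (ex μ (ind A1 * ind A3) - ex μ (ind A1 * ind A2 * ind A3)) + (ex μ (ind A1 * ind A2) - ex μ (ind A1 * ind A2 * ind A3))) * (1 - ex μ (ind A0)) * (1 - ex μ (ind A4))
            + ((ex μ (ind A2 * ind A4) - ex μ (ind A1 * ind A2 * ind A4)) + (ex μ (ind A1 * ind A4) - ex μ (ind A1 * ind A2 * ind A4)) + (ex μ (ind A1 * ind A2) - ex μ (ind A1 * ind A2 * ind A4))) * (1 - ex μ (ind A0)) * (1 - ex μ (ind A3))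
            + ((ex μ (ind A3 * ind A4) - ex μ (ind A1 * ind A3 * ind A4)) + (ex μ (ind A1 * ind A4) - ex μ (ind A1 * ind A3 * ind A4)) + (ex μ (ind A1 * ind A3) - ex μ (ind A1 * ind A3 * ind A4))) * (1 - ex μ (ind A0)) * (1 - ex μ (ind A2))
            + ((ex μ (ind A3 * ind A4) - ex μ (ind A2 * ind A3 * ind A4)) + (ex μ (ind A2 * ind A4) - ex μ (ind A2 * ind A3 * ind A4)) + (ex μ (ind A2 * ind A3) - ex μ (ind A2 * ind A3 * ind A4))) * (1 - ex μ (ind A0)) * (1 - ex μ (ind A1)))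
          + ((1 - ex μ (ind A0)) * ((1 / 3) * ((1 - ex μ (ind A1 * ind A2)) * (1 - ex μ (ind A3 * ind A4))) + (1 / 6) * ((1 - ex μ (ind A1 * ind A2)) * (ex μ (ind A4) - ex μ (ind A3 * ind A4))) + (1 / 6) * ((1 - ex μ (ind A1 * ind A2)) * (ex μ (ind A3) - ex μ (ind A3 * ind A4))) + (1 / 6) * ((1 - ex μ (ind A3 * ind A4)) * (ex μ (ind A2) - ex μ (ind A1 * ind A2))) + (1 / 6) * ((1 - ex μ (ind A3 * ind A4)) * (ex μ (ind A1) - ex μ (ind A1 * ind A2))))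
            + (1 - ex μ (ind A0)) * ((1 / 3) * ((1 - ex μ (ind A1 * ind A3)) * (1 - ex μ (ind A2 * ind A4))) + (1 / 6) * ((1 - ex μ (ind A1 * ind A3)) * (ex μ (ind A4) - ex μ (ind A2 * ind A4))) + (1 / 6) * ((1 - ex μ (ind A1 * ind A3)) * (ex μ (ind A2) - ex μ (ind A2 * ind A4))) + (1 / 6) * ((1 - ex μ (ind A2 * ind A4)) * (ex μ (ind A3) - ex μ (ind A1 * ind A3))) + (1 / 6) * ((1 - ex μ (ind A2 * ind A4)) * (ex μ (ind A1) - ex μ (ind A1 * ind A3))))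
            + (1 - ex μ (ind A0)) * ((1 / 3) * ((1 - ex μ (ind A1 * ind A4)) * (1 - ex μ (ind A2 * ind A3))) + (1 / 6) * ((1 - ex μ (ind A1 * ind A4)) * (ex μ (ind A3) - ex μ (ind A2 * ind A3))) + (1 / 6) * ((1 - ex μ (ind A1 * ind A4)) * (ex μ (ind A2) - ex μ (ind A2 * ind A3))) + (1 / 6) * ((1 - ex μ (ind A2 * ind A3)) * (ex μ (ind A4) - ex μ (ind A1 * ind A4))) + (1 / 6) * ((1 - ex μ (ind A2 * ind A3)) * (ex μ (ind A1) - ex μ (ind A1 * ind A4))))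
            + (1 - ex μ (ind A1)) * ((1 / 3) * ((1 - ex μ (ind A0 * ind A2)) * (1 - ex μ (ind A3 * ind A4))) + (1 / 6) * ((1 - ex μ (ind A0 * ind A2)) * (ex μ (ind A4) - ex μ (ind A3 * ind A4))) + (1 / 6) * ((1 - ex μ (ind A0 * ind A2)) * (ex μ (ind A3) - ex μ (ind A3 * ind A4))) + (1 / 6) * ((1 - ex μ (ind A3 * ind A4)) * (ex μ (ind A2) - ex μ (ind A0 * ind A2))) + (1 / 6) * ((1 - ex μ (ind A3 * ind A4)) * (ex μ (ind A0) - ex μ (ind A0 * ind A2))))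
            + (1 - ex μ (ind A1)) * ((1 / 3) * ((1 - ex μ (ind A0 * ind A3)) * (1 - ex μ (ind A2 * ind A4))) + (1 / 6) * ((1 - ex μ (ind A0 * ind A3)) * (ex μ (ind A4) - ex μ (ind A2 * ind A4))) + (1 / 6) * ((1 - ex μ (ind A0 * ind A3)) * (ex μ (ind A2) - ex μ (ind A2 * ind A4))) + (1 / 6) * ((1 - ex μ (ind A2 * ind A4)) * (ex μ (ind A3) - ex μ (ind A0 * ind A3))) + (1 / 6) * ((1 - ex μ (ind A2 * ind A4)) * (ex μ (ind A0) - ex μ (ind A0 * ind A3))))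
            + (1 - ex μ (ind A1)) * ((1 / 3) * ((1 - ex μ (ind A0 * ind A4)) * (1 - ex μ (ind A2 * ind A3))) + (1 / 6) * ((1 - ex μ (ind A0 * ind A4)) * (ex μ (ind A3) - ex μ (ind A2 * ind A3))) + (1 / 6) * ((1 - ex μ (ind A0 * ind A4)) * (ex μ (ind A2) - ex μ (ind A2 * ind A3))) + (1 / 6) * ((1 - ex μ (ind A2 * ind A3)) * (ex μ (ind A4) - ex μ (ind A0 * ind A4))) + (1 / 6) * ((1 - ex μ (ind A2 * ind A3)) * (ex μ (ind A0) - ex μ (ind A0 * ind A4))))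
            + (1 - ex μ (ind A2)) * ((1 / 3) * ((1 - ex μ (ind A0 * ind A1)) * (1 - ex μ (ind A3 * ind A4))) + (1 / 6) * ((1 - ex μ (ind A0 * ind A1)) * (ex μ (ind A4) - ex μ (ind A3 * ind A4))) + (1 / 6) * ((1 - ex μ (ind A0 * ind A1)) * (ex μ (ind A3) - ex μ (ind A3 * ind A4))) + (1 / 6) * ((1 - ex μ (ind A3 * ind A4)) * (ex μ (ind A1) - ex μ (ind A0 * ind A1))) + (1 / 6) * ((1 - ex μ (ind A3 * ind A4)) * (ex μ (ind A0) - ex μ (ind A0 * ind A1))))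
            + (1 - ex μ (ind A2)) * ((1 / 3) * ((1 - ex μ (ind A0 * ind A3)) * (1 - ex μ (ind A1 * ind A4))) + (1 / 6) * ((1 - ex μ (ind A0 * ind A3)) * (ex μ (ind A4) - ex μ (ind A1 * ind A4))) + (1 / 6) * ((1 - ex μ (ind A0 * ind A3)) * (ex μ (ind A1) - ex μ (ind A1 * ind A4))) + (1 / 6) * ((1 - ex μ (ind A1 * ind A4)) * (ex μ (ind A3) - ex μ (ind A0 * ind A3))) + (1 / 6) * ((1 - ex μ (ind A1 * ind A4)) * (ex μ (ind A0) - ex μ (ind A0 * ind A3))))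
            + (1 - ex μ (ind A2)) * ((1 / 3) * ((1 - ex μ (ind A0 * ind A4)) * (1 - ex μ (ind A1 * ind A3))) + (1 / 6) * ((1 - ex μ (ind A0 * ind A4)) * (ex μ (ind A3) - ex μ (ind A1 * ind A3))) + (1 / 6) * ((1 - ex μ (ind A0 * ind A4)) * (ex μ (ind A1) - ex μ (ind A1 * ind A3))) + (1 / 6) * ((1 - ex μ (ind A1 * ind A3)) * (ex μ (ind A4) - ex μ (ind A0 * ind A4))) + (1 / 6) * ((1 - ex μ (ind A1 * ind A3)) * (ex μ (ind A0) - ex μ (ind A0 * ind A4))))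
            + (1 - ex μ (ind A3)) * ((1 / 3) * ((1 - ex μ (ind A0 * ind A1)) * (1 - ex μ (ind A2 * ind A4))) + (1 / 6) * ((1 - ex μ (ind A0 * ind A1)) * (ex μ (ind A4) - ex μ (ind A2 * ind A4))) + (1 / 6) * ((1 - ex μ (ind A0 * ind A1)) * (ex μ (ind A2) - ex μ (ind A2 * ind A4))) + (1 / 6) * ((1 - ex μ (ind A2 * ind A4)) * (ex μ (ind A1) - ex μ (ind A0 * ind A1))) + (1 / 6) * ((1 - ex μ (ind A2 * ind A4)) * (ex μ (ind A0) - ex μ (ind A0 * ind A1))))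
            + (1 - ex μ (ind A3)) * ((1 / 3) * ((1 - ex μ (ind A0 * ind A2)) * (1 - ex μ (ind A1 * ind A4))) + (1 / 6) * ((1 - ex μ (ind A0 * ind A2)) * (ex μ (ind A4) - ex μ (ind A1 * ind A4))) + (1 / 6) * ((1 - ex μ (ind A0 * ind A2)) * (ex μ (ind A1) - ex μ (ind A1 * ind A4))) + (1 / 6) * ((1 - ex μ (ind A1 * ind A4)) * (ex μ (ind A2) - ex μ (ind A0 * ind A2))) + (1 / 6) * ((1 - ex μ (ind A1 * ind A4)) * (ex μ (ind A0) - ex μ (ind A0 * ind A2))))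
            + (1 - ex μ (ind A3)) * ((1 / 3) * ((1 - ex μ (ind A0 * ind A4)) * (1 - ex μ (ind A1 * ind A2))) + (1 / 6) * ((1 - ex μ (ind A0 * ind A4)) * (ex μ (ind A2) - ex μ (ind A1 * ind A2))) + (1 / 6) * ((1 - ex μ (ind A0 * ind A4)) * (ex μ (ind A1) - ex μ (ind A1 * ind A2))) + (1 / 6) * ((1 - ex μ (ind A1 * ind A2)) * (ex μ (ind A4) - ex μ (ind A0 * ind A4))) + (1 / 6) * ((1 - ex μ (ind A1 * ind A2)) * (ex μ (ind A0) - ex μ (ind A0 * ind A4))))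
            + (1 - ex μ (ind A4)) * ((1 / 3) * ((1 - ex μ (ind A0 * ind A1)) * (1 - ex μ (ind A2 * ind A3))) + (1 / 6) * ((1 - ex μ (ind A0 * ind A1)) * (ex μ (ind A3) - ex μ (ind A2 * ind A3))) + (1 / 6) * ((1 - ex μ (ind A0 * ind A1)) * (ex μ (ind A2) - ex μ (ind A2 * ind A3))) + (1 / 6) * ((1 - ex μ (ind A2 * ind A3)) * (ex μ (ind A1) - ex μ (ind A0 * ind A1))) + (1 / 6) * ((1 - ex μ (ind A2 * ind A3)) * (ex μ (ind A0) - ex μ (ind A0 * ind A1))))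
            + (1 - ex μ (ind A4)) * ((1 / 3) * ((1 - ex μ (ind A0 * ind A2)) * (1 - ex μ (ind A1 * ind A3))) + (1 / 6) * ((1 - ex μ (ind A0 * ind A2)) * (ex μ (ind A3) - ex μ (ind A1 * ind A3))) + (1 / 6) * ((1 - ex μ (ind A0 * ind A2)) * (ex μ (ind A1) - ex μ (ind A1 * ind A3))) + (1 / 6) * ((1 - ex μ (ind A1 * ind A3)) * (ex μ (ind A2) - ex μ (ind A0 * ind A2))) + (1 / 6) * ((1 - ex μ (ind A1 * ind A3)) * (ex μ (ind A0) - ex μ (ind A0 * ind A2))))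
            + (1 - ex μ (ind A4)) * ((1 / 3) * ((1 - ex μ (ind A0 * ind A3)) * (1 - ex μ (ind A1 * ind A2))) + (1 / 6) * ((1 - ex μ (ind A0 * ind A3)) * (ex μ (ind A2) - ex μ (ind A1 * ind A2))) + (1 / 6) * ((1 - ex μ (ind A0 * ind A3)) * (ex μ (ind A1) - ex μ (ind A1 * ind A2))) + (1 / 6) * ((1 - ex μ (ind A1 * ind A2)) * (ex μ (ind A3) - ex μ (ind A0 * ind A3))) + (1 / 6) * ((1 - ex μ (ind A1 * ind A2)) * (ex μ (ind A0) - ex μ (ind A0 * ind A3))))))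
        + h * (1 - h) ^ 2 * (2 - h) *
          (((1 - ex μ (ind A1)) * (1 - ex μ (ind A2)) * (1 - ex μ (ind A3)) * (1 - ex μ (ind A4)) + (1 - ex μ (ind A0)) * (1 - ex μ (ind A2)) * (1 - ex μ (ind A3)) * (1 - ex μ (ind A4)) + (1 - ex μ (ind A0)) * (1 - ex μ (ind A1)) * (1 - ex μ (ind A3)) * (1 - ex μ (ind A4)) + (1 - ex μ (ind A0)) * (1 - ex μ (ind A1)) * (1 - ex μ (ind A2)) * (1 - ex μ (ind A4)) + (1 - ex μ (ind A0)) * (1 - ex μ (ind A1)) * (1 - ex μ (ind A2)) * (1 - ex μ (ind A3)))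
          + (1 / 2) * ((ex μ (ind A0) - ex μ (ind A0 * ind A1)) * (1 - ex μ (ind A2)) * (1 - ex μ (ind A3)) * (1 - ex μ (ind A4))
            + (ex μ (ind A0) - ex μ (ind A0 * ind A2)) * (1 - ex μ (ind A1)) * (1 - ex μ (ind A3)) * (1 - ex μ (ind A4))
            + (ex μ (ind A0) - ex μ (ind A0 * ind A3)) * (1 - ex μ (ind A1)) * (1 - ex μ (ind A2)) * (1 - ex μ (ind A4))
            + (ex μ (ind A0) - ex μ (ind A0 * ind A4)) * (1 - ex μ (ind A1)) * (1 - ex μ (ind A2)) * (1 - ex μ (ind A3))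
            + (ex μ (ind A1) - ex μ (ind A0 * ind A1)) * (1 - ex μ (ind A2)) * (1 - ex μ (ind A3)) * (1 - ex μ (ind A4))
            + (ex μ (ind A1) - ex μ (ind A1 * ind A2)) * (1 - ex μ (ind A0)) * (1 - ex μ (ind A3)) * (1 - ex μ (ind A4))
            + (ex μ (ind A1) - ex μ (ind A1 * ind A3)) * (1 - ex μ (ind A0)) * (1 - ex μ (ind A2)) * (1 - ex μ (ind A4))
            + (ex μ (ind A1) - ex μ (ind A1 * ind A4)) * (1 - ex μ (ind A0)) * (1 - ex μ (ind A2)) * (1 - ex μ (ind A3))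
            + (ex μ (ind A2) - ex μ (ind A0 * ind A2)) * (1 - ex μ (ind A1)) * (1 - ex μ (ind A3)) * (1 - ex μ (ind A4))
            + (ex μ (ind A2) - ex μ (ind A1 * ind A2)) * (1 - ex μ (ind A0)) * (1 - ex μ (ind A3)) * (1 - ex μ (ind A4))
            + (ex μ (ind A2) - ex μ (ind A2 * ind A3)) * (1 - ex μ (ind A0)) * (1 - ex μ (ind A1)) * (1 - ex μ (ind A4))
            + (ex μ (ind A2) - ex μ (ind A2 * ind A4)) * (1 - ex μ (ind A0)) * (1 - ex μ (ind A1)) * (1 - ex μ (ind A3))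
            + (ex μ (ind A3) - ex μ (ind A0 * ind A3)) * (1 - ex μ (ind A1)) * (1 - ex μ (ind A2)) * (1 - ex μ (ind A4))
            + (ex μ (ind A3) - ex μ (ind A1 * ind A3)) * (1 - ex μ (ind A0)) * (1 - ex μ (ind A2)) * (1 - ex μ (ind A4))
            + (ex μ (ind A3) - ex μ (ind A2 * ind A3)) * (1 - ex μ (ind A0)) * (1 - ex μ (ind A1)) * (1 - ex μ (ind A4))
            + (ex μ (ind A3) - ex μ (ind A3 * ind A4)) * (1 - ex μ (ind A0)) * (1 - ex μ (ind A1)) * (1 - ex μ (ind A2))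
            + (ex μ (ind A4) - ex μ (ind A0 * ind A4)) * (1 - ex μ (ind A1)) * (1 - ex μ (ind A2)) * (1 - ex μ (ind A3))
            + (ex μ (ind A4) - ex μ (ind A1 * ind A4)) * (1 - ex μ (ind A0)) * (1 - ex μ (ind A2)) * (1 - ex μ (ind A3))
            + (ex μ (ind A4) - ex μ (ind A2 * ind A4)) * (1 - ex μ (ind A0)) * (1 - ex μ (ind A1)) * (1 - ex μ (ind A3))
            + (ex μ (ind A4) - ex μ (ind A3 * ind A4)) * (1 - ex μ (ind A0)) * (1 - ex μ (ind A1)) * (1 - ex μ (ind A2))))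
        + h * (1 - h) ^ 2 * (1 + (1 - h) + (1 - h) ^ 2) * ((1 - ex μ (ind A0)) * (1 - ex μ (ind A1)) * (1 - ex μ (ind A2)) * (1 - ex μ (ind A3)) * (1 - ex μ (ind A4))) := by
  rw [sahiE_five, sahiE_five]
  simp only [exc_or₅, exc_or₄, exc_or₃, exc_or₂, exc_or₁ μ h hμ1, cond_true, mul_one, ex_one hμ1]
  ring

include hμ hμ1 in
set_option maxHeartbeats 1600000 in
/-- **TOP(5) from the top row alone**: if `E_5(A_0,…,A_4) ≥ 0` then `h ↦ E_5(A_0∪H,…,A_4∪H)` is Bernstein-positive of degree `5`. [this work] -/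
theorem bernsteinPos_five_orCoin_top (hE5 : 0 ≤ sahiE μ 5 ![ind A0, ind A1, ind A2, ind A3, ind A4]) :
    BernsteinPos 5 (fun h => sahiE (coinWeight μ h) 5
      ![ind (orCoin A0 true), ind (orCoin A1 true), ind (orCoin A2 true), ind (orCoin A3 true), ind (orCoin A4 true)]) := by
  -- T^(1) = 6·μ(|C| ≤ 3) ≥ 0
  have hT1 : 0 ≤ 6 * (1 - (ex μ (ind A1 * ind A2 * ind A3 * ind A4) + ex μ (ind A0 * ind A2 * ind A3 * ind A4) + ex μ (ind A0 * ind A1 * ind A3 * ind A4) + ex μ (ind A0 * ind A1 * ind A2 * ind A4) + ex μ (ind A0 * ind A1 * ind A2 * ind A3)) + 4 * ex μ (ind A0 * ind A1 * ind A2 * ind A3 * ind A4)) := by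
    have hg : ∀ x, 0 ≤ 1 - (ind A1 x * ind A2 x * ind A3 x * ind A4 x + ind A0 x * ind A2 x * ind A3 x * ind A4 x + ind A0 x * ind A1 x * ind A3 x * ind A4 x + ind A0 x * ind A1 x * ind A2 x * ind A4 x + ind A0 x * ind A1 x * ind A2 x * ind A3 x) + 4 * (ind A0 x * ind A1 x * ind A2 x * ind A3 x * ind A4 x) := fun x => by
      by_cases h0 : x ∈ A0 <;> by_cases h1 : x ∈ A1 <;> by_cases h2 : x ∈ A2 <;> by_cases h3 : x ∈ A3 <;> by_cases h4 : x ∈ A4 <;>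
        norm_num [ind_of_mem, ind_of_not_mem, h0, h1, h2, h3, h4]
    have e := ex_eq_lin μ (fun x => 1 - (ind A1 x * ind A2 x * ind A3 x * ind A4 x + ind A0 x * ind A2 x * ind A3 x * ind A4 x + ind A0 x * ind A1 x * ind A3 x * ind A4 x + ind A0 x * ind A1 x * ind A2 x * ind A4 x + ind A0 x * ind A1 x * ind A2 x * ind A3 x) + 4 * (ind A0 x * ind A1 x * ind A2 x * ind A3 x * ind A4 x))
      ![1, -1, -1, -1, -1, -1, 4]
      ![fun _ => 1, ind A1 * ind A2 * ind A3 * ind A4, ind A0 * ind A2 * ind A3 * ind A4, ind A0 * ind A1 * ind A3 * ind A4, ind A0 * ind A1 * ind A2 * ind A4, ind A0 * ind A1 * ind A2 * ind A3, ind A0 * ind A1 * ind A2 * ind A3 * ind A4]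
      (fun x => by simp [Fin.sum_univ_succ]; ring)
    simp only [Fin.sum_univ_succ, Fin.sum_univ_zero, Matrix.cons_val_zero, Matrix.cons_val_succ, ex_const hμ1] at e
    have h0 := ex_nonneg hμ hg
    linarith
  -- atomic nonnegative quantities
  have d0 : 0 ≤ (1 - ex μ (ind A0)) :=
    one_sub_ex_ind_nonneg hμ hμ1 A0
  have d1 : 0 ≤ (1 - ex μ (ind A1)) :=
    one_sub_ex_ind_nonneg hμ hμ1 A1
  have d2 : 0 ≤ (1 - ex μ (ind A2)) :=
    one_sub_ex_ind_nonneg hμ hμ1 A2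
  have d3 : 0 ≤ (1 - ex μ (ind A3)) :=
    one_sub_ex_ind_nonneg hμ hμ1 A3
  have d4 : 0 ≤ (1 - ex μ (ind A4)) :=
    one_sub_ex_ind_nonneg hμ hμ1 A4
  have d01 : 0 ≤ (1 - ex μ (ind A0 * ind A1)) :=
    one_sub_ex_nonneg_of_le_one hμ hμ1 _ (fun x => mul_le_one₀ (ind_le_one _ x) (ind_nonneg _ x) (ind_le_one _ x))
  have d02 : 0 ≤ (1 - ex μ (ind A0 * ind A2)) :=
    one_sub_ex_nonneg_of_le_one hμ hμ1 _ (fun x => mul_le_one₀ (ind_le_one _ x) (ind_nonneg _ x) (ind_le_one _ x))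
  have d03 : 0 ≤ (1 - ex μ (ind A0 * ind A3)) :=
    one_sub_ex_nonneg_of_le_one hμ hμ1 _ (fun x => mul_le_one₀ (ind_le_one _ x) (ind_nonneg _ x) (ind_le_one _ x))
  have d04 : 0 ≤ (1 - ex μ (ind A0 * ind A4)) :=
    one_sub_ex_nonneg_of_le_one hμ hμ1 _ (fun x => mul_le_one₀ (ind_le_one _ x) (ind_nonneg _ x) (ind_le_one _ x))
  have d12 : 0 ≤ (1 - ex μ (ind A1 * ind A2)) :=
    one_sub_ex_nonneg_of_le_one hμ hμ1 _ (fun x => mul_le_one₀ (ind_le_one _ x) (ind_nonneg _ x) (ind_le_one _ x))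
  have d13 : 0 ≤ (1 - ex μ (ind A1 * ind A3)) :=
    one_sub_ex_nonneg_of_le_one hμ hμ1 _ (fun x => mul_le_one₀ (ind_le_one _ x) (ind_nonneg _ x) (ind_le_one _ x))
  have d14 : 0 ≤ (1 - ex μ (ind A1 * ind A4)) :=
    one_sub_ex_nonneg_of_le_one hμ hμ1 _ (fun x => mul_le_one₀ (ind_le_one _ x) (ind_nonneg _ x) (ind_le_one _ x))
  have d23 : 0 ≤ (1 - ex μ (ind A2 * ind A3)) :=
    one_sub_ex_nonneg_of_le_one hμ hμ1 _ (fun x => mul_le_one₀ (ind_le_one _ x) (ind_nonneg _ x) (ind_le_one _ x))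
  have d24 : 0 ≤ (1 - ex μ (ind A2 * ind A4)) :=
    one_sub_ex_nonneg_of_le_one hμ hμ1 _ (fun x => mul_le_one₀ (ind_le_one _ x) (ind_nonneg _ x) (ind_le_one _ x))
  have d34 : 0 ≤ (1 - ex μ (ind A3 * ind A4)) :=
    one_sub_ex_nonneg_of_le_one hμ hμ1 _ (fun x => mul_le_one₀ (ind_le_one _ x) (ind_nonneg _ x) (ind_le_one _ x))
  have x0_01 : 0 ≤ (ex μ (ind A0) - ex μ (ind A0 * ind A1)) :=
    ex_ind_sub_ex_mul_nonneg_left hμ A0 A1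
  have x1_01 : 0 ≤ (ex μ (ind A1) - ex μ (ind A0 * ind A1)) :=
    ex_ind_sub_ex_mul_nonneg_right hμ A0 A1
  have x0_02 : 0 ≤ (ex μ (ind A0) - ex μ (ind A0 * ind A2)) :=
    ex_ind_sub_ex_mul_nonneg_left hμ A0 A2
  have x2_02 : 0 ≤ (ex μ (ind A2) - ex μ (ind A0 * ind A2)) :=
    ex_ind_sub_ex_mul_nonneg_right hμ A0 A2
  have x0_03 : 0 ≤ (ex μ (ind A0) - ex μ (ind A0 * ind A3)) :=
    ex_ind_sub_ex_mul_nonneg_left hμ A0 A3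
  have x3_03 : 0 ≤ (ex μ (ind A3) - ex μ (ind A0 * ind A3)) :=
    ex_ind_sub_ex_mul_nonneg_right hμ A0 A3
  have x0_04 : 0 ≤ (ex μ (ind A0) - ex μ (ind A0 * ind A4)) :=
    ex_ind_sub_ex_mul_nonneg_left hμ A0 A4
  have x4_04 : 0 ≤ (ex μ (ind A4) - ex μ (ind A0 * ind A4)) :=
    ex_ind_sub_ex_mul_nonneg_right hμ A0 A4
  have x1_12 : 0 ≤ (ex μ (ind A1) - ex μ (ind A1 * ind A2)) :=
    ex_ind_sub_ex_mul_nonneg_left hμ A1 A2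
  have x2_12 : 0 ≤ (ex μ (ind A2) - ex μ (ind A1 * ind A2)) :=
    ex_ind_sub_ex_mul_nonneg_right hμ A1 A2
  have x1_13 : 0 ≤ (ex μ (ind A1) - ex μ (ind A1 * ind A3)) :=
    ex_ind_sub_ex_mul_nonneg_left hμ A1 A3
  have x3_13 : 0 ≤ (ex μ (ind A3) - ex μ (ind A1 * ind A3)) :=
    ex_ind_sub_ex_mul_nonneg_right hμ A1 A3
  have x1_14 : 0 ≤ (ex μ (ind A1) - ex μ (ind A1 * ind A4)) :=
    ex_ind_sub_ex_mul_nonneg_left hμ A1 A4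
  have x4_14 : 0 ≤ (ex μ (ind A4) - ex μ (ind A1 * ind A4)) :=
    ex_ind_sub_ex_mul_nonneg_right hμ A1 A4
  have x2_23 : 0 ≤ (ex μ (ind A2) - ex μ (ind A2 * ind A3)) :=
    ex_ind_sub_ex_mul_nonneg_left hμ A2 A3
  have x3_23 : 0 ≤ (ex μ (ind A3) - ex μ (ind A2 * ind A3)) :=
    ex_ind_sub_ex_mul_nonneg_right hμ A2 A3
  have x2_24 : 0 ≤ (ex μ (ind A2) - ex μ (ind A2 * ind A4)) :=
    ex_ind_sub_ex_mul_nonneg_left hμ A2 A4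
  have x4_24 : 0 ≤ (ex μ (ind A4) - ex μ (ind A2 * ind A4)) :=
    ex_ind_sub_ex_mul_nonneg_right hμ A2 A4
  have x3_34 : 0 ≤ (ex μ (ind A3) - ex μ (ind A3 * ind A4)) :=
    ex_ind_sub_ex_mul_nonneg_left hμ A3 A4
  have x4_34 : 0 ≤ (ex μ (ind A4) - ex μ (ind A3 * ind A4)) :=
    ex_ind_sub_ex_mul_nonneg_right hμ A3 A4
  have y12_012 : 0 ≤ (ex μ (ind A1 * ind A2) - ex μ (ind A0 * ind A1 * ind A2)) :=
    sub_nonneg.2 (ex_mono hμ fun x => by simpa only [Pi.mul_apply] using mul_le_mul_of_nonneg_right (mul_le_of_le_one_left (ind_nonneg A1 x) (ind_le_one A0 x)) (ind_nonneg A2 x))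
  have y02_012 : 0 ≤ (ex μ (ind A0 * ind A2) - ex μ (ind A0 * ind A1 * ind A2)) :=
    sub_nonneg.2 (ex_mono hμ fun x => by simpa only [Pi.mul_apply] using mul_le_mul_of_nonneg_right (mul_le_of_le_one_right (ind_nonneg A0 x) (ind_le_one A1 x)) (ind_nonneg A2 x))
  have y01_012 : 0 ≤ (ex μ (ind A0 * ind A1) - ex μ (ind A0 * ind A1 * ind A2)) :=
    sub_nonneg.2 (ex_mono hμ fun x => by simpa only [Pi.mul_apply] using mul_le_of_le_one_right (mul_nonneg (ind_nonneg A0 x) (ind_nonneg A1 x)) (ind_le_one A2 x))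
  have y13_013 : 0 ≤ (ex μ (ind A1 * ind A3) - ex μ (ind A0 * ind A1 * ind A3)) :=
    sub_nonneg.2 (ex_mono hμ fun x => by simpa only [Pi.mul_apply] using mul_le_mul_of_nonneg_right (mul_le_of_le_one_left (ind_nonneg A1 x) (ind_le_one A0 x)) (ind_nonneg A3 x))
  have y03_013 : 0 ≤ (ex μ (ind A0 * ind A3) - ex μ (ind A0 * ind A1 * ind A3)) :=
    sub_nonneg.2 (ex_mono hμ fun x => by simpa only [Pi.mul_apply] using mul_le_mul_of_nonneg_right (mul_le_of_le_one_right (ind_nonneg A0 x) (ind_le_one A1 x)) (ind_nonneg A3 x))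
  have y01_013 : 0 ≤ (ex μ (ind A0 * ind A1) - ex μ (ind A0 * ind A1 * ind A3)) :=
    sub_nonneg.2 (ex_mono hμ fun x => by simpa only [Pi.mul_apply] using mul_le_of_le_one_right (mul_nonneg (ind_nonneg A0 x) (ind_nonneg A1 x)) (ind_le_one A3 x))
  have y14_014 : 0 ≤ (ex μ (ind A1 * ind A4) - ex μ (ind A0 * ind A1 * ind A4)) :=
    sub_nonneg.2 (ex_mono hμ fun x => by simpa only [Pi.mul_apply] using mul_le_mul_of_nonneg_right (mul_le_of_le_one_left (ind_nonneg A1 x) (ind_le_one A0 x)) (ind_nonneg A4 x))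
  have y04_014 : 0 ≤ (ex μ (ind A0 * ind A4) - ex μ (ind A0 * ind A1 * ind A4)) :=
    sub_nonneg.2 (ex_mono hμ fun x => by simpa only [Pi.mul_apply] using mul_le_mul_of_nonneg_right (mul_le_of_le_one_right (ind_nonneg A0 x) (ind_le_one A1 x)) (ind_nonneg A4 x))
  have y01_014 : 0 ≤ (ex μ (ind A0 * ind A1) - ex μ (ind A0 * ind A1 * ind A4)) :=
    sub_nonneg.2 (ex_mono hμ fun x => by simpa only [Pi.mul_apply] using mul_le_of_le_one_right (mul_nonneg (ind_nonneg A0 x) (ind_nonneg A1 x)) (ind_le_one A4 x))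
  have y23_023 : 0 ≤ (ex μ (ind A2 * ind A3) - ex μ (ind A0 * ind A2 * ind A3)) :=
    sub_nonneg.2 (ex_mono hμ fun x => by simpa only [Pi.mul_apply] using mul_le_mul_of_nonneg_right (mul_le_of_le_one_left (ind_nonneg A2 x) (ind_le_one A0 x)) (ind_nonneg A3 x))
  have y03_023 : 0 ≤ (ex μ (ind A0 * ind A3) - ex μ (ind A0 * ind A2 * ind A3)) :=
    sub_nonneg.2 (ex_mono hμ fun x => by simpa only [Pi.mul_apply] using mul_le_mul_of_nonneg_right (mul_le_of_le_one_right (ind_nonneg A0 x) (ind_le_one A2 x)) (ind_nonneg A3 x))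
  have y02_023 : 0 ≤ (ex μ (ind A0 * ind A2) - ex μ (ind A0 * ind A2 * ind A3)) :=
    sub_nonneg.2 (ex_mono hμ fun x => by simpa only [Pi.mul_apply] using mul_le_of_le_one_right (mul_nonneg (ind_nonneg A0 x) (ind_nonneg A2 x)) (ind_le_one A3 x))
  have y24_024 : 0 ≤ (ex μ (ind A2 * ind A4) - ex μ (ind A0 * ind A2 * ind A4)) :=
    sub_nonneg.2 (ex_mono hμ fun x => by simpa only [Pi.mul_apply] using mul_le_mul_of_nonneg_right (mul_le_of_le_one_left (ind_nonneg A2 x) (ind_le_one A0 x)) (ind_nonneg A4 x))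
  have y04_024 : 0 ≤ (ex μ (ind A0 * ind A4) - ex μ (ind A0 * ind A2 * ind A4)) :=
    sub_nonneg.2 (ex_mono hμ fun x => by simpa only [Pi.mul_apply] using mul_le_mul_of_nonneg_right (mul_le_of_le_one_right (ind_nonneg A0 x) (ind_le_one A2 x)) (ind_nonneg A4 x))
  have y02_024 : 0 ≤ (ex μ (ind A0 * ind A2) - ex μ (ind A0 * ind A2 * ind A4)) :=
    sub_nonneg.2 (ex_mono hμ fun x => by simpa only [Pi.mul_apply] using mul_le_of_le_one_right (mul_nonneg (ind_nonneg A0 x) (ind_nonneg A2 x)) (ind_le_one A4 x))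
  have y34_034 : 0 ≤ (ex μ (ind A3 * ind A4) - ex μ (ind A0 * ind A3 * ind A4)) :=
    sub_nonneg.2 (ex_mono hμ fun x => by simpa only [Pi.mul_apply] using mul_le_mul_of_nonneg_right (mul_le_of_le_one_left (ind_nonneg A3 x) (ind_le_one A0 x)) (ind_nonneg A4 x))
  have y04_034 : 0 ≤ (ex μ (ind A0 * ind A4) - ex μ (ind A0 * ind A3 * ind A4)) :=
    sub_nonneg.2 (ex_mono hμ fun x => by simpa only [Pi.mul_apply] using mul_le_mul_of_nonneg_right (mul_le_of_le_one_right (ind_nonneg A0 x) (ind_le_one A3 x)) (ind_nonneg A4 x))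
  have y03_034 : 0 ≤ (ex μ (ind A0 * ind A3) - ex μ (ind A0 * ind A3 * ind A4)) :=
    sub_nonneg.2 (ex_mono hμ fun x => by simpa only [Pi.mul_apply] using mul_le_of_le_one_right (mul_nonneg (ind_nonneg A0 x) (ind_nonneg A3 x)) (ind_le_one A4 x))
  have y23_123 : 0 ≤ (ex μ (ind A2 * ind A3) - ex μ (ind A1 * ind A2 * ind A3)) :=
    sub_nonneg.2 (ex_mono hμ fun x => by simpa only [Pi.mul_apply] using mul_le_mul_of_nonneg_right (mul_le_of_le_one_left (ind_nonneg A2 x) (ind_le_one A1 x)) (ind_nonneg A3 x))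
  have y13_123 : 0 ≤ (ex μ (ind A1 * ind A3) - ex μ (ind A1 * ind A2 * ind A3)) :=
    sub_nonneg.2 (ex_mono hμ fun x => by simpa only [Pi.mul_apply] using mul_le_mul_of_nonneg_right (mul_le_of_le_one_right (ind_nonneg A1 x) (ind_le_one A2 x)) (ind_nonneg A3 x))
  have y12_123 : 0 ≤ (ex μ (ind A1 * ind A2) - ex μ (ind A1 * ind A2 * ind A3)) :=
    sub_nonneg.2 (ex_mono hμ fun x => by simpa only [Pi.mul_apply] using mul_le_of_le_one_right (mul_nonneg (ind_nonneg A1 x) (ind_nonneg A2 x)) (ind_le_one A3 x))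
  have y24_124 : 0 ≤ (ex μ (ind A2 * ind A4) - ex μ (ind A1 * ind A2 * ind A4)) :=
    sub_nonneg.2 (ex_mono hμ fun x => by simpa only [Pi.mul_apply] using mul_le_mul_of_nonneg_right (mul_le_of_le_one_left (ind_nonneg A2 x) (ind_le_one A1 x)) (ind_nonneg A4 x))
  have y14_124 : 0 ≤ (ex μ (ind A1 * ind A4) - ex μ (ind A1 * ind A2 * ind A4)) :=
    sub_nonneg.2 (ex_mono hμ fun x => by simpa only [Pi.mul_apply] using mul_le_mul_of_nonneg_right (mul_le_of_le_one_right (ind_nonneg A1 x) (ind_le_one A2 x)) (ind_nonneg A4 x))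
  have y12_124 : 0 ≤ (ex μ (ind A1 * ind A2) - ex μ (ind A1 * ind A2 * ind A4)) :=
    sub_nonneg.2 (ex_mono hμ fun x => by simpa only [Pi.mul_apply] using mul_le_of_le_one_right (mul_nonneg (ind_nonneg A1 x) (ind_nonneg A2 x)) (ind_le_one A4 x))
  have y34_134 : 0 ≤ (ex μ (ind A3 * ind A4) - ex μ (ind A1 * ind A3 * ind A4)) :=
    sub_nonneg.2 (ex_mono hμ fun x => by simpa only [Pi.mul_apply] using mul_le_mul_of_nonneg_right (mul_le_of_le_one_left (ind_nonneg A3 x) (ind_le_one A1 x)) (ind_nonneg A4 x))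
  have y14_134 : 0 ≤ (ex μ (ind A1 * ind A4) - ex μ (ind A1 * ind A3 * ind A4)) :=
    sub_nonneg.2 (ex_mono hμ fun x => by simpa only [Pi.mul_apply] using mul_le_mul_of_nonneg_right (mul_le_of_le_one_right (ind_nonneg A1 x) (ind_le_one A3 x)) (ind_nonneg A4 x))
  have y13_134 : 0 ≤ (ex μ (ind A1 * ind A3) - ex μ (ind A1 * ind A3 * ind A4)) :=
    sub_nonneg.2 (ex_mono hμ fun x => by simpa only [Pi.mul_apply] using mul_le_of_le_one_right (mul_nonneg (ind_nonneg A1 x) (ind_nonneg A3 x)) (ind_le_one A4 x))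
  have y34_234 : 0 ≤ (ex μ (ind A3 * ind A4) - ex μ (ind A2 * ind A3 * ind A4)) :=
    sub_nonneg.2 (ex_mono hμ fun x => by simpa only [Pi.mul_apply] using mul_le_mul_of_nonneg_right (mul_le_of_le_one_left (ind_nonneg A3 x) (ind_le_one A2 x)) (ind_nonneg A4 x))
  have y24_234 : 0 ≤ (ex μ (ind A2 * ind A4) - ex μ (ind A2 * ind A3 * ind A4)) :=
    sub_nonneg.2 (ex_mono hμ fun x => by simpa only [Pi.mul_apply] using mul_le_mul_of_nonneg_right (mul_le_of_le_one_right (ind_nonneg A2 x) (ind_le_one A3 x)) (ind_nonneg A4 x))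
  have y23_234 : 0 ≤ (ex μ (ind A2 * ind A3) - ex μ (ind A2 * ind A3 * ind A4)) :=
    sub_nonneg.2 (ex_mono hμ fun x => by simpa only [Pi.mul_apply] using mul_le_of_le_one_right (mul_nonneg (ind_nonneg A2 x) (ind_nonneg A3 x)) (ind_le_one A4 x))
  have hN3 : 0 ≤ (2 / 3) * (((ex μ (ind A1 * ind A2) - ex μ (ind A0 * ind A1 * ind A2)) + (ex μ (ind A0 * ind A2) - ex μ (ind A0 * ind A1 * ind A2)) + (ex μ (ind A0 * ind A1) - ex μ (ind A0 * ind A1 * ind A2))) * (1 - ex μ (ind A3)) * (1 - ex μ (ind A4))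
            + ((ex μ (ind A1 * ind A3) - ex μ (ind A0 * ind A1 * ind A3)) + (ex μ (ind A0 * ind A3) - ex μ (ind A0 * ind A1 * ind A3)) + (ex μ (ind A0 * ind A1) - ex μ (ind A0 * ind A1 * ind A3))) * (1 - ex μ (ind A2)) * (1 - ex μ (ind A4))
            + ((ex μ (ind A1 * ind A4) - ex μ (ind A0 * ind A1 * ind A4)) + (ex μ (ind A0 * ind A4) - ex μ (ind A0 * ind A1 * ind A4)) + (ex μ (ind A0 * ind A1) - ex μ (ind A0 * ind A1 * ind A4))) * (1 - ex μ (ind A2)) * (1 - ex μ (ind A3))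
            + ((ex μ (ind A2 * ind A3) - ex μ (ind A0 * ind A2 * ind A3)) + (ex μ (ind A0 * ind A3) - ex μ (ind A0 * ind A2 * ind A3)) + (ex μ (ind A0 * ind A2) - ex μ (ind A0 * ind A2 * ind A3))) * (1 - ex μ (ind A1)) * (1 - ex μ (ind A4))
            + ((ex μ (ind A2 * ind A4) - ex μ (ind A0 * ind A2 * ind A4)) + (ex μ (ind A0 * ind A4) - ex μ (ind A0 * ind A2 * ind A4)) + (ex μ (ind A0 * ind A2) - ex μ (ind A0 * ind A2 * ind A4))) * (1 - ex μ (ind A1)) * (1 - ex μ (ind A3))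
            + ((ex μ (ind A3 * ind A4) - ex μ (ind A0 * ind A3 * ind A4)) + (ex μ (ind A0 * ind A4) - ex μ (ind A0 * ind A3 * ind A4)) + (ex μ (ind A0 * ind A3) - ex μ (ind A0 * ind A3 * ind A4))) * (1 - ex μ (ind A1)) * (1 - ex μ (ind A2))
            + ((ex μ (ind A2 * ind A3) - ex μ (ind A1 * ind A2 * ind A3)) + (ex μ (ind A1 * ind A3) - ex μ (ind A1 * ind A2 * ind A3)) + (ex μ (ind A1 * ind A2) - ex μ (ind A1 * ind A2 * ind A3))) * (1 - ex μ (ind A0)) * (1 - ex μ (ind A4))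
            + ((ex μ (ind A2 * ind A4) - ex μ (ind A1 * ind A2 * ind A4)) + (ex μ (ind A1 * ind A4) - ex μ (ind A1 * ind A2 * ind A4)) + (ex μ (ind A1 * ind A2) - ex μ (ind A1 * ind A2 * ind A4))) * (1 - ex μ (ind A0)) * (1 - ex μ (ind A3))
            + ((ex μ (ind A3 * ind A4) - ex μ (ind A1 * ind A3 * ind A4)) + (ex μ (ind A1 * ind A4) - ex μ (ind A1 * ind A3 * ind A4)) + (ex μ (ind A1 * ind A3) - ex μ (ind A1 * ind A3 * ind A4))) * (1 - ex μ (ind A0)) * (1 - ex μ (ind A2))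
            + ((ex μ (ind A3 * ind A4) - ex μ (ind A2 * ind A3 * ind A4)) + (ex μ (ind A2 * ind A4) - ex μ (ind A2 * ind A3 * ind A4)) + (ex μ (ind A2 * ind A3) - ex μ (ind A2 * ind A3 * ind A4))) * (1 - ex μ (ind A0)) * (1 - ex μ (ind A1)))
          + ((1 - ex μ (ind A0)) * ((1 / 3) * ((1 - ex μ (ind A1 * ind A2)) * (1 - ex μ (ind A3 * ind A4))) + (1 / 6) * ((1 - ex μ (ind A1 * ind A2)) * (ex μ (ind A4) - ex μ (ind A3 * ind A4))) + (1 / 6) * ((1 - ex μ (ind A1 * ind A2)) * (ex μ (ind A3) - ex μ (ind A3 * ind A4))) + (1 / 6) * ((1 - ex μ (ind A3 * ind A4)) * (ex μ (ind A2) - ex μ (ind A1 * ind A2))) + (1 / 6) * ((1 - ex μ (ind A3 * ind A4)) * (ex μ (ind A1) - ex μ (ind A1 * ind A2))))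
            + (1 - ex μ (ind A0)) * ((1 / 3) * ((1 - ex μ (ind A1 * ind A3)) * (1 - ex μ (ind A2 * ind A4))) + (1 / 6) * ((1 - ex μ (ind A1 * ind A3)) * (ex μ (ind A4) - ex μ (ind A2 * ind A4))) + (1 / 6) * ((1 - ex μ (ind A1 * ind A3)) * (ex μ (ind A2) - ex μ (ind A2 * ind A4))) + (1 / 6) * ((1 - ex μ (ind A2 * ind A4)) * (ex μ (ind A3) - ex μ (ind A1 * ind A3))) + (1 / 6) * ((1 - ex μ (ind A2 * ind A4)) * (ex μ (ind A1) - ex μ (ind A1 * ind A3))))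
            + (1 - ex μ (ind A0)) * ((1 / 3) * ((1 - ex μ (ind A1 * ind A4)) * (1 - ex μ (ind A2 * ind A3))) + (1 / 6) * ((1 - ex μ (ind A1 * ind A4)) * (ex μ (ind A3) - ex μ (ind A2 * ind A3))) + (1 / 6) * ((1 - ex μ (ind A1 * ind A4)) * (ex μ (ind A2) - ex μ (ind A2 * ind A3))) + (1 / 6) * ((1 - ex μ (ind A2 * ind A3)) * (ex μ (ind A4) - ex μ (ind A1 * ind A4))) + (1 / 6) * ((1 - ex μ (ind A2 * ind A3)) * (ex μ (ind A1) - ex μ (ind A1 * ind A4))))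
            + (1 - ex μ (ind A1)) * ((1 / 3) * ((1 - ex μ (ind A0 * ind A2)) * (1 - ex μ (ind A3 * ind A4))) + (1 / 6) * ((1 - ex μ (ind A0 * ind A2)) * (ex μ (ind A4) - ex μ (ind A3 * ind A4))) + (1 / 6) * ((1 - ex μ (ind A0 * ind A2)) * (ex μ (ind A3) - ex μ (ind A3 * ind A4))) + (1 / 6) * ((1 - ex μ (ind A3 * ind A4)) * (ex μ (ind A2) - ex μ (ind A0 * ind A2))) + (1 / 6) * ((1 - ex μ (ind A3 * ind A4)) * (ex μ (ind A0) - ex μ (ind A0 * ind A2))))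
            + (1 - ex μ (ind A1)) * ((1 / 3) * ((1 - ex μ (ind A0 * ind A3)) * (1 - ex μ (ind A2 * ind A4))) + (1 / 6) * ((1 - ex μ (ind A0 * ind A3)) * (ex μ (ind A4) - ex μ (ind A2 * ind A4))) + (1 / 6) * ((1 - ex μ (ind A0 * ind A3)) * (ex μ (ind A2) - ex μ (ind A2 * ind A4))) + (1 / 6) * ((1 - ex μ (ind A2 * ind A4)) * (ex μ (ind A3) - ex μ (ind A0 * ind A3))) + (1 / 6) * ((1 - ex μ (ind A2 * ind A4)) * (ex μ (ind A0) - ex μ (ind A0 * ind A3))))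
            + (1 - ex μ (ind A1)) * ((1 / 3) * ((1 - ex μ (ind A0 * ind A4)) * (1 - ex μ (ind A2 * ind A3))) + (1 / 6) * ((1 - ex μ (ind A0 * ind A4)) * (ex μ (ind A3) - ex μ (ind A2 * ind A3))) + (1 / 6) * ((1 - ex μ (ind A0 * ind A4)) * (ex μ (ind A2) - ex μ (ind A2 * ind A3))) + (1 / 6) * ((1 - ex μ (ind A2 * ind A3)) * (ex μ (ind A4) - ex μ (ind A0 * ind A4))) + (1 / 6) * ((1 - ex μ (ind A2 * ind A3)) * (ex μ (ind A0) - ex μ (ind A0 * ind A4))))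
            + (1 - ex μ (ind A2)) * ((1 / 3) * ((1 - ex μ (ind A0 * ind A1)) * (1 - ex μ (ind A3 * ind A4))) + (1 / 6) * ((1 - ex μ (ind A0 * ind A1)) * (ex μ (ind A4) - ex μ (ind A3 * ind A4))) + (1 / 6) * ((1 - ex μ (ind A0 * ind A1)) * (ex μ (ind A3) - ex μ (ind A3 * ind A4))) + (1 / 6) * ((1 - ex μ (ind A3 * ind A4)) * (ex μ (ind A1) - ex μ (ind A0 * ind A1))) + (1 / 6) * ((1 - ex μ (ind A3 * ind A4)) * (ex μ (ind A0) - ex μ (ind A0 * ind A1))))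
            + (1 - ex μ (ind A2)) * ((1 / 3) * ((1 - ex μ (ind A0 * ind A3)) * (1 - ex μ (ind A1 * ind A4))) + (1 / 6) * ((1 - ex μ (ind A0 * ind A3)) * (ex μ (ind A4) - ex μ (ind A1 * ind A4))) + (1 / 6) * ((1 - ex μ (ind A0 * ind A3)) * (ex μ (ind A1) - ex μ (ind A1 * ind A4))) + (1 / 6) * ((1 - ex μ (ind A1 * ind A4)) * (ex μ (ind A3) - ex μ (ind A0 * ind A3))) + (1 / 6) * ((1 - ex μ (ind A1 * ind A4)) * (ex μ (ind A0) - ex μ (ind A0 * ind A3))))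
            + (1 - ex μ (ind A2)) * ((1 / 3) * ((1 - ex μ (ind A0 * ind A4)) * (1 - ex μ (ind A1 * ind A3))) + (1 / 6) * ((1 - ex μ (ind A0 * ind A4)) * (ex μ (ind A3) - ex μ (ind A1 * ind A3))) + (1 / 6) * ((1 - ex μ (ind A0 * ind A4)) * (ex μ (ind A1) - ex μ (ind A1 * ind A3))) + (1 / 6) * ((1 - ex μ (ind A1 * ind A3)) * (ex μ (ind A4) - ex μ (ind A0 * ind A4))) + (1 / 6) * ((1 - ex μ (ind A1 * ind A3)) * (ex μ (ind A0) - ex μ (ind A0 * ind A4))))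
            + (1 - ex μ (ind A3)) * ((1 / 3) * ((1 - ex μ (ind A0 * ind A1)) * (1 - ex μ (ind A2 * ind A4))) + (1 / 6) * ((1 - ex μ (ind A0 * ind A1)) * (ex μ (ind A4) - ex μ (ind A2 * ind A4))) + (1 / 6) * ((1 - ex μ (ind A0 * ind A1)) * (ex μ (ind A2) - ex μ (ind A2 * ind A4))) + (1 / 6) * ((1 - ex μ (ind A2 * ind A4)) * (ex μ (ind A1) - ex μ (ind A0 * ind A1))) + (1 / 6) * ((1 - ex μ (ind A2 * ind A4)) * (ex μ (ind A0) - ex μ (ind A0 * ind A1))))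
            + (1 - ex μ (ind A3)) * ((1 / 3) * ((1 - ex μ (ind A0 * ind A2)) * (1 - ex μ (ind A1 * ind A4))) + (1 / 6) * ((1 - ex μ (ind A0 * ind A2)) * (ex μ (ind A4) - ex μ (ind A1 * ind A4))) + (1 / 6) * ((1 - ex μ (ind A0 * ind A2)) * (ex μ (ind A1) - ex μ (ind A1 * ind A4))) + (1 / 6) * ((1 - ex μ (ind A1 * ind A4)) * (ex μ (ind A2) - ex μ (ind A0 * ind A2))) + (1 / 6) * ((1 - ex μ (ind A1 * ind A4)) * (ex μ (ind A0) - ex μ (ind A0 * ind A2))))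
            + (1 - ex μ (ind A3)) * ((1 / 3) * ((1 - ex μ (ind A0 * ind A4)) * (1 - ex μ (ind A1 * ind A2))) + (1 / 6) * ((1 - ex μ (ind A0 * ind A4)) * (ex μ (ind A2) - ex μ (ind A1 * ind A2))) + (1 / 6) * ((1 - ex μ (ind A0 * ind A4)) * (ex μ (ind A1) - ex μ (ind A1 * ind A2))) + (1 / 6) * ((1 - ex μ (ind A1 * ind A2)) * (ex μ (ind A4) - ex μ (ind A0 * ind A4))) + (1 / 6) * ((1 - ex μ (ind A1 * ind A2)) * (ex μ (ind A0) - ex μ (ind A0 * ind A4))))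
            + (1 - ex μ (ind A4)) * ((1 / 3) * ((1 - ex μ (ind A0 * ind A1)) * (1 - ex μ (ind A2 * ind A3))) + (1 / 6) * ((1 - ex μ (ind A0 * ind A1)) * (ex μ (ind A3) - ex μ (ind A2 * ind A3))) + (1 / 6) * ((1 - ex μ (ind A0 * ind A1)) * (ex μ (ind A2) - ex μ (ind A2 * ind A3))) + (1 / 6) * ((1 - ex μ (ind A2 * ind A3)) * (ex μ (ind A1) - ex μ (ind A0 * ind A1))) + (1 / 6) * ((1 - ex μ (ind A2 * ind A3)) * (ex μ (ind A0) - ex μ (ind A0 * ind A1))))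
            + (1 - ex μ (ind A4)) * ((1 / 3) * ((1 - ex μ (ind A0 * ind A2)) * (1 - ex μ (ind A1 * ind A3))) + (1 / 6) * ((1 - ex μ (ind A0 * ind A2)) * (ex μ (ind A3) - ex μ (ind A1 * ind A3))) + (1 / 6) * ((1 - ex μ (ind A0 * ind A2)) * (ex μ (ind A1) - ex μ (ind A1 * ind A3))) + (1 / 6) * ((1 - ex μ (ind A1 * ind A3)) * (ex μ (ind A2) - ex μ (ind A0 * ind A2))) + (1 / 6) * ((1 - ex μ (ind A1 * ind A3)) * (ex μ (ind A0) - ex μ (ind A0 * ind A2))))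
            + (1 - ex μ (ind A4)) * ((1 / 3) * ((1 - ex μ (ind A0 * ind A3)) * (1 - ex μ (ind A1 * ind A2))) + (1 / 6) * ((1 - ex μ (ind A0 * ind A3)) * (ex μ (ind A2) - ex μ (ind A1 * ind A2))) + (1 / 6) * ((1 - ex μ (ind A0 * ind A3)) * (ex μ (ind A1) - ex μ (ind A1 * ind A2))) + (1 / 6) * ((1 - ex μ (ind A1 * ind A2)) * (ex μ (ind A3) - ex μ (ind A0 * ind A3))) + (1 / 6) * ((1 - ex μ (ind A1 * ind A2)) * (ex μ (ind A0) - ex μ (ind A0 * ind A3))))) := by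
    positivity
  have hN4 : 0 ≤ ((1 - ex μ (ind A1)) * (1 - ex μ (ind A2)) * (1 - ex μ (ind A3)) * (1 - ex μ (ind A4)) + (1 - ex μ (ind A0)) * (1 - ex μ (ind A2)) * (1 - ex μ (ind A3)) * (1 - ex μ (ind A4)) + (1 - ex μ (ind A0)) * (1 - ex μ (ind A1)) * (1 - ex μ (ind A3)) * (1 - ex μ (ind A4)) + (1 - ex μ (ind A0)) * (1 - ex μ (ind A1)) * (1 - ex μ (ind A2)) * (1 - ex μ (ind A4)) + (1 - ex μ (ind A0)) * (1 - ex μ (ind A1)) * (1 - ex μ (ind A2)) * (1 - ex μ (ind A3)))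
          + (1 / 2) * ((ex μ (ind A0) - ex μ (ind A0 * ind A1)) * (1 - ex μ (ind A2)) * (1 - ex μ (ind A3)) * (1 - ex μ (ind A4))
            + (ex μ (ind A0) - ex μ (ind A0 * ind A2)) * (1 - ex μ (ind A1)) * (1 - ex μ (ind A3)) * (1 - ex μ (ind A4))
            + (ex μ (ind A0) - ex μ (ind A0 * ind A3)) * (1 - ex μ (ind A1)) * (1 - ex μ (ind A2)) * (1 - ex μ (ind A4))
            + (ex μ (ind A0) - ex μ (ind A0 * ind A4)) * (1 - ex μ (ind A1)) * (1 - ex μ (ind A2)) * (1 - ex μ (ind A3))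
            + (ex μ (ind A1) - ex μ (ind A0 * ind A1)) * (1 - ex μ (ind A2)) * (1 - ex μ (ind A3)) * (1 - ex μ (ind A4))
            + (ex μ (ind A1) - ex μ (ind A1 * ind A2)) * (1 - ex μ (ind A0)) * (1 - ex μ (ind A3)) * (1 - ex μ (ind A4))
            + (ex μ (ind A1) - ex μ (ind A1 * ind A3)) * (1 - ex μ (ind A0)) * (1 - ex μ (ind A2)) * (1 - ex μ (ind A4))
            + (ex μ (ind A1) - ex μ (ind A1 * ind A4)) * (1 - ex μ (ind A0)) * (1 - ex μ (ind A2)) * (1 - ex μ (ind A3))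
            + (ex μ (ind A2) - ex μ (ind A0 * ind A2)) * (1 - ex μ (ind A1)) * (1 - ex μ (ind A3)) * (1 - ex μ (ind A4))
            + (ex μ (ind A2) - ex μ (ind A1 * ind A2)) * (1 - ex μ (ind A0)) * (1 - ex μ (ind A3)) * (1 - ex μ (ind A4))
            + (ex μ (ind A2) - ex μ (ind A2 * ind A3)) * (1 - ex μ (ind A0)) * (1 - ex μ (ind A1)) * (1 - ex μ (ind A4))
            + (ex μ (ind A2) - ex μ (ind A2 * ind A4)) * (1 - ex μ (ind A0)) * (1 - ex μ (ind A1)) * (1 - ex μ (ind A3))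
            + (ex μ (ind A3) - ex μ (ind A0 * ind A3)) * (1 - ex μ (ind A1)) * (1 - ex μ (ind A2)) * (1 - ex μ (ind A4))
            + (ex μ (ind A3) - ex μ (ind A1 * ind A3)) * (1 - ex μ (ind A0)) * (1 - ex μ (ind A2)) * (1 - ex μ (ind A4))
            + (ex μ (ind A3) - ex μ (ind A2 * ind A3)) * (1 - ex μ (ind A0)) * (1 - ex μ (ind A1)) * (1 - ex μ (ind A4))
            + (ex μ (ind A3) - ex μ (ind A3 * ind A4)) * (1 - ex μ (ind A0)) * (1 - ex μ (ind A1)) * (1 - ex μ (ind A2))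
            + (ex μ (ind A4) - ex μ (ind A0 * ind A4)) * (1 - ex μ (ind A1)) * (1 - ex μ (ind A2)) * (1 - ex μ (ind A3))
            + (ex μ (ind A4) - ex μ (ind A1 * ind A4)) * (1 - ex μ (ind A0)) * (1 - ex μ (ind A2)) * (1 - ex μ (ind A3))
            + (ex μ (ind A4) - ex μ (ind A2 * ind A4)) * (1 - ex μ (ind A0)) * (1 - ex μ (ind A1)) * (1 - ex μ (ind A3))
            + (ex μ (ind A4) - ex μ (ind A3 * ind A4)) * (1 - ex μ (ind A0)) * (1 - ex μ (ind A1)) * (1 - ex μ (ind A2))) := by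
    positivity
  have hN5 : 0 ≤ (1 - ex μ (ind A0)) * (1 - ex μ (ind A1)) * (1 - ex μ (ind A2)) * (1 - ex μ (ind A3)) * (1 - ex μ (ind A4)) := by positivity
  -- Bernstein pieces
  have bp4 : BernsteinPos 4 (fun h : ℝ => h * (1 - h) ^ 2 * ((1 - h) * 2 + h * 1)) :=
    bp_hg2.mul (bernsteinPos_affine (show (0:ℝ) ≤ 2 by norm_num) (show (0:ℝ) ≤ 1 by norm_num))
  have bq : BernsteinPos 2 (fun h : ℝ => 1 + (1 - h) + (1 - h) ^ 2) :=
    (((bp_g2.smul (show (0:ℝ) ≤ 3 by norm_num)).add (bp_hg.smul (show (0:ℝ) ≤ 3 by norm_num))).add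
      (bp_h2.smul (show (0:ℝ) ≤ 1 by norm_num))).congr fun h _ _ => by ring
  have bp5 : BernsteinPos 5 (fun h : ℝ => h * (1 - h) ^ 2 * (1 + (1 - h) + (1 - h) ^ 2)) := bp_hg2.mul bq
  refine ((((((bp_hg.smul hT1).mono (by norm_num : 2 ≤ 5)).add ((bp_g2.smul hE5).mono (by norm_num : 2 ≤ 5))).add
    ((bp_hg2.smul hN3).mono (by norm_num : 3 ≤ 5))).add ((bp4.smul hN4).mono (by norm_num : 4 ≤ 5))).add (bp5.smul hN5)).congr
    fun h _ _ => ?_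
  rw [sahiE_five_orCoin_top_eq hμ1 A0 A1 A2 A3 A4 h]
  ring

end TopFive

end SahiMixture

end Summit.CriticalPhenomena.PercolationContinuityZ3.Theorems

end
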